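import Summits.MatrixMultiplication.OmegaCensus.STPPKernelListerScanSound

/-!
# ω-census (abelian STPP census): kernel lister — the packed knapsack certificate bounds every extension (kernel)

HONEST FRAMING (pub-omega census; verbatim): lottery ticket; floor = certified bounds/negative ranges.
Census STRUCTURE (seat pub-omega-stpp-2 gen 29, 2026-08-29), family (b2).  Pure combinatorics; nothing here is progress on `ω`.

`KLister.chunksOK W L = true` (checked by `decide` on the literal tables, e.g. `chunksOK_Z61`) is unfolded into the Prop-level certificate `ChunkCert` and
shown to give the COVERAGE needed by the search (`ChunksCov (CovC W) L`, `STPPKernelListerScanSound.lean`): for every chunk `(rows, ss)` and every count-vector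
extension `E` (in list order) by shapes of this chunk or later ones, and every budget index `i < 4` and column `c < W` with `Σ_{e∈E} cost_i e ≤ c`:
`Σ_{e∈E} vol e ≤ lk rows[i] c`.  Proof: split `E` into its part over the chunk's own shapes and the rest; the rest is bounded by the NEXT chunk's row
(induction) hence by this row (column-wise domination); the own part is peeled shape by shape with the local inequality `vol s + row[c − cost s] ≤ row[c]`
and monotonicity in the column.
-/

namespace Summit.MatrixMultiplication.OmegaCensus.KLister

/-! ## Costs and sums -/

/-- The `i`-th budget cost of a shape (`i < 4`: `maxflat, qa, qb, qc`). [folklore] -/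
def costI (i : ℕ) (s : Shape) : ℕ := (costs s).getD i 0

/-- `Σ cost_i` over a list of shapes. [folklore] -/
def sumCost (i : ℕ) (E : List Shape) : ℕ := (E.map (costI i)).sum

/-- `Σ vol` over a list of shapes. [folklore] -/
def sumVol (E : List Shape) : ℕ := (E.map svol).sum

/-- `Σ cost` of `[]`. [folklore] -/
@[simp] theorem sumCost_nil (i : ℕ) : sumCost i [] = 0 := rfl
/-- `Σ cost` of a cons. [folklore] -/
@[simp] theorem sumCost_cons (i : ℕ) (e : Shape) (E : List Shape) : sumCost i (e :: E) = costI i e + sumCost i E := by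
  simp [sumCost]
/-- `Σ vol` of `[]`. [folklore] -/
@[simp] theorem sumVol_nil : sumVol [] = 0 := rfl
/-- `Σ vol` of a cons. [folklore] -/
@[simp] theorem sumVol_cons (e : Shape) (E : List Shape) : sumVol (e :: E) = svol e + sumVol E := by simp [sumVol]
/-- `Σ cost` of an append. [folklore] -/
theorem sumCost_append (i : ℕ) (E F : List Shape) : sumCost i (E ++ F) = sumCost i E + sumCost i F := by
  simp [sumCost, List.sum_append]
/-- `Σ vol` of an append. [folklore] -/
theorem sumVol_append (E F : List Shape) : sumVol (E ++ F) = sumVol E + sumVol F := by simp [sumVol, List.sum_append]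

/-- `costs s` has length `4`. [folklore] -/
theorem length_costs (s : Shape) : (costs s).length = 4 := rfl

/-! ## Splitting an extension at an append -/

/-- An extension of `A ++ B` splits into an extension of `A` followed by an extension of `B`. [folklore] -/
theorem OrdExt.split {A B E : List Shape} (h : OrdExt (A ++ B) E) : ∃ E₁ E₂, E = E₁ ++ E₂ ∧ OrdExt A E₁ ∧ OrdExt B E₂ := by
  induction A generalizing E with
  | nil => exact ⟨[], E, rfl, OrdExt.nil, by simpa using h⟩
  | cons a A ih =>
    -- peel the copies of `a` at the front of `E`
    have key : ∀ E, OrdExt (a :: (A ++ B)) E → ∃ E₁ E₂, E = E₁ ++ E₂ ∧ OrdExt (a :: A) E₁ ∧ OrdExt B E₂ := by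
      intro E hE
      -- induction on the length of E to peel leading copies
      induction E using List.rec with
      | nil =>
        rcases hE.cons_cases with h0 | ⟨E', hE', _⟩
        · obtain ⟨E₁, E₂, h1, h2, h3⟩ := ih h0
          exact ⟨E₁, E₂, h1, OrdExt.skip h2, h3⟩
        · exact absurd hE' (by simp)
      | cons e E ihE =>
        rcases hE.cons_cases with h0 | ⟨E', hE', h'⟩
        · obtain ⟨E₁, E₂, h1, h2, h3⟩ := ih h0
          exact ⟨E₁, E₂, h1, OrdExt.skip h2, h3⟩
        · obtain ⟨he, hEE⟩ := List.cons.inj hE'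
          subst he; subst hEE
          obtain ⟨E₁, E₂, h1, h2, h3⟩ := ihE h'
          exact ⟨e :: E₁, E₂, by simp [h1], OrdExt.take h2, h3⟩
    exact key E (by simpa using h)

/-- Every element of an extension lies in the base list. [folklore] -/
theorem OrdExt.mem {R E : List Shape} (h : OrdExt R E) : ∀ e ∈ E, e ∈ R := by
  induction h with
  | nil => simp
  | skip _ ih => intro e he; exact List.mem_cons_of_mem _ (ih e he)
  | take _ ih =>
    intro e he
    rcases List.mem_cons.1 he with rfl | he
    · exact List.mem_cons_self
    · exact ih e he

/-! ## The Prop-level certificate -/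

/-- Column-monotone packed row on `[0, W)`. [folklore] -/
def RowMono (W r : ℕ) : Prop := ∀ c, c + 1 < W → lk r c ≤ lk r (c + 1)

/-- Peel inequality of a packed row for a shape and a cost. [folklore] -/
def RowPeel (W r v w : ℕ) : Prop := ∀ c, c < W → w ≤ c → v + lk r (c - w) ≤ lk r c

/-- Prop-level content of `rowsOK W rows ss`. [folklore] -/
def RowsCert (W : ℕ) (rows : List ℕ) (ss : List Shape) : Prop :=
  rows.length = 4 ∧ (∀ i, i < 4 → RowMono W (rows.getD i 0)) ∧ ∀ s ∈ ss, ∀ i, i < 4 → RowPeel W (rows.getD i 0) (svol s) (costI i s)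

/-- Column-wise domination of the next chunk's rows. [folklore] -/
def RowsDom (W : ℕ) (rows rows' : List ℕ) : Prop := ∀ i, i < 4 → ∀ c, c < W → lk (rows'.getD i 0) c ≤ lk (rows.getD i 0) c

/-- Prop-level content of `chunksOK W L`. [folklore] -/
def ChunkCert (W : ℕ) : List (List ℕ × List Shape) → Prop
  | [] => True
  | [(rows, ss)] => RowsCert W rows ss
  | (rows, ss) :: (rows', ss') :: rest => RowsCert W rows ss ∧ rows'.length = 4 ∧ RowsDom W rows rows' ∧ ChunkCert W ((rows', ss') :: rest)

/-- From a monotone row: `lk r` is monotone on `[0, W)`. [folklore] -/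
theorem RowMono.le {W r : ℕ} (h : RowMono W r) {c c' : ℕ} (hcc : c ≤ c') (hc' : c' < W) : lk r c ≤ lk r c' := by
  induction c' with
  | zero => simp at hcc; subst hcc; exact le_rfl
  | succ c' ih =>
    rcases Nat.eq_or_lt_of_le hcc with rfl | hlt
    · exact le_rfl
    · exact (ih (Nat.lt_succ_iff.1 hlt) (by omega)).trans (h c' hc')

/-! ## Unfolding the Boolean certificate -/

/-- `rowsOK` gives `RowsCert`. [folklore] -/
theorem rowsCert_of_rowsOK {W : ℕ} {rows : List ℕ} {ss : List Shape} (h : rowsOK W rows ss = true) : RowsCert W rows ss := by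
  simp only [rowsOK, Bool.and_eq_true, List.all_eq_true, List.mem_range, Nat.ble_eq, Bool.or_eq_true, Nat.blt_eq] at h
  obtain ⟨⟨hlen0, hmono⟩, hpeel⟩ := h
  have hlen : rows.length = 4 := Nat.eq_of_beq_eq_true hlen0
  refine ⟨hlen, fun i hi c hc => ?_, fun s hs i hi c hc hw => ?_⟩
  · have hmem : rows.getD i 0 ∈ rows := by
      rw [List.getD_eq_getElem _ _ (by omega)]; exact List.getElem_mem _
    exact hmono _ hmem c (by omega)
  · have hz : (rows.getD i 0, costI i s) ∈ List.zip rows (costs s) := by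
      rw [List.getD_eq_getElem _ _ (by omega), costI, List.getD_eq_getElem _ _ (by rw [length_costs]; omega)]
      have hi' : i < (List.zip rows (costs s)).length := by rw [List.length_zip, hlen, length_costs]; omega
      have := List.getElem_mem hi'
      rwa [List.getElem_zip] at this
    have h2 := hpeel s hs _ hz c hc
    rcases h2 with h2 | h2
    · omega
    · exact h2

/-- `chunksOK` gives `ChunkCert`. [folklore] -/
theorem chunkCert_of_chunksOK {W : ℕ} : ∀ L : List (List ℕ × List Shape), chunksOK W L = true → ChunkCert W L
  | [], _ => trivial
  | [(rows, ss)], h => by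
    rw [chunksOK] at h
    exact rowsCert_of_rowsOK h
  | (rows, ss) :: (rows', ss') :: rest, h => by
    rw [chunksOK, Bool.and_eq_true, Bool.and_eq_true] at h
    obtain ⟨⟨h1, h2⟩, h3⟩ := h
    have hc' : ChunkCert W ((rows', ss') :: rest) := chunkCert_of_chunksOK _ h3
    have hlen' : rows'.length = 4 := by
      cases rest with
      | nil => exact (hc' : RowsCert W rows' ss').1
      | cons ch rest' => obtain ⟨r2, s2⟩ := ch; exact hc'.1.1
    have hlen : rows.length = 4 := (rowsCert_of_rowsOK h1).1
    refine ⟨rowsCert_of_rowsOK h1, hlen', fun i hi c hc => ?_, hc'⟩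
    simp only [List.all_eq_true, List.mem_range, Nat.ble_eq] at h2
    have hz : (rows.getD i 0, rows'.getD i 0) ∈ List.zip rows rows' := by
      rw [List.getD_eq_getElem _ _ (by omega), List.getD_eq_getElem _ _ (by omega)]
      have hi' : i < (List.zip rows rows').length := by rw [List.length_zip, hlen, hlen']; omega
      have := List.getElem_mem hi'
      rwa [List.getElem_zip] at this
    exact h2 _ hz c hc

/-! ## Peeling and the coverage -/

/-- Peeling a list of shapes, each with the peel inequality, off a monotone row. [folklore] -/
theorem peel_list {W r i : ℕ} (hm : RowMono W r) :
    ∀ (E : List Shape), (∀ e ∈ E, RowPeel W r (svol e) (costI i e)) →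
      ∀ c c₂, c < W → sumCost i E + c₂ ≤ c → sumVol E + lk r c₂ ≤ lk r c := by
  intro E
  induction E with
  | nil =>
    intro _ c c₂ hc h
    simp only [sumCost_nil, sumVol_nil, Nat.zero_add] at h ⊢
    exact hm.le h hc
  | cons e E ih =>
    intro hp c c₂ hc h
    rw [sumCost_cons] at h
    rw [sumVol_cons]
    have h1 : sumVol E + lk r c₂ ≤ lk r (c - costI i e) :=
      ih (fun e' he' => hp e' (List.mem_cons_of_mem _ he')) (c - costI i e) c₂ (by omega) (by omega)
    have h2 : svol e + lk r (c - costI i e) ≤ lk r c := hp e List.mem_cons_self c hc (by omega)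
    omega

/-- The concrete coverage predicate: every count-vector extension over `R` is volume-bounded by the rows through its costs. [folklore] -/
def CovC (W : ℕ) (rows : List ℕ) (R : List Shape) : Prop :=
  ∀ E, OrdExt R E → ∀ i, i < 4 → ∀ c, c < W → sumCost i E ≤ c → sumVol E ≤ lk (rows.getD i 0) c

/-- Coverage is inherited by dropping a leading shape. [folklore] -/
theorem CovC.tail {W : ℕ} {rows : List ℕ} {s : Shape} {R : List Shape} (h : CovC W rows (s :: R)) : CovC W rows R :=
  fun E hE => h E (OrdExt.skip hE)

/-- **The certificate gives the coverage of every chunk.** [folklore] -/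
theorem chunksCov_of_chunkCert {W : ℕ} : ∀ L : List (List ℕ × List Shape), ChunkCert W L → ChunksCov (CovC W) L
  | [], _ => trivial
  | [(rows, ss)], h => by
    refine ⟨?_, trivial⟩
    intro E hE i hi c hc hcost
    have hE' : OrdExt ss E := by simpa [flat] using hE
    obtain ⟨_, hmono, hpeel⟩ := (h : RowsCert W rows ss)
    have := peel_list (hmono i hi) E (fun e he => hpeel e (hE'.mem e he) i hi) c 0 hc (by omega)
    have h0 : 0 ≤ lk (rows.getD i 0) 0 := Nat.zero_le _
    omega
  | (rows, ss) :: (rows', ss') :: rest, h => by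
    obtain ⟨hcert, _, hdom, hrest⟩ := h
    have ih := chunksCov_of_chunkCert ((rows', ss') :: rest) hrest
    refine ⟨?_, ih⟩
    intro E hE i hi c hc hcost
    rw [flat_cons] at hE
    obtain ⟨E₁, E₂, rfl, h1, h2⟩ := hE.split
    obtain ⟨_, hmono, hpeel⟩ := hcert
    rw [sumCost_append] at hcost
    rw [sumVol_append]
    -- the rest `E₂` is bounded by the next chunk's row, hence by this row
    have hE₂ : sumVol E₂ ≤ lk (rows.getD i 0) (sumCost i E₂) := by
      have h' := ih.1 E₂ h2 i hi (sumCost i E₂) (by omega) le_rfl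
      exact h'.trans (hdom i hi _ (by omega))
    have := peel_list (hmono i hi) E₁ (fun e he => hpeel e (h1.mem e he) i hi) c (sumCost i E₂) hc (by omega)
    omega

/-- **`chunksOK` ⇒ coverage** (the form used by the capstone). [folklore] -/
theorem chunksCov_of_chunksOK {W : ℕ} {L : List (List ℕ × List Shape)} (h : chunksOK W L = true) : ChunksCov (CovC W) L :=
  chunksCov_of_chunkCert L (chunkCert_of_chunksOK L h)

end Summit.MatrixMultiplication.OmegaCensus.KLister
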